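import Mathlib
import Summits.NavierStokesRegularity.OSWSelfSimilar.TypeIIInnerLimitZoomOseen
import HarnessLib
/-!
# Case B from the standing hypotheses: a receding max-centred zoom of an axisymmetric blow-up solution has a constant
# inner object (zone Z1 TEMPLATE §T1.4-I (I-2)/(I-3), kernel)

HONEST FRAMING (cell ns-blowup GROUP B «PROFILE SEARCH», zone Z1; D-0035/D-0074): part XXI of the Z1 dictionary — the
Case-B branch of (I-3) with EVERY hypothesis on the pre-limit solution: `u` classical (`ν = 1`, unforced) on
`[0, T⋆) × ℝ³`, AXISYMMETRIC, bounded with bounded energy on closed sub-slabs (K8's standing hypotheses); zoom data in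
gauge N-a (`λₖ‖u‖ ≤ 1` on `[0, tₖ]`, `λₖ‖u(tₖ, xₖ)‖ → 1`, `λₖ → 0`, `tₖ ≥ t₁ > 0` — produced by part XX
`exists_zoom_data_of_unbounded` from unboundedness) with the near-max centres chosen in the MERIDIONAL half-plane,
`xₖ = rₖ e₀ + zₖ e₂` (always possible for an axisymmetric field, `‖u(t, R_θ x)‖ = ‖u(t, x)‖`; here a hypothesis), and
CASE B: `dₖ = rₖ/λₖ → ∞`. Then the zoom slices are axisymmetric about the receding axes through `−dₖ e₀` (part XV
`zoom_rot_about`), so by part XIX `innerLimit_const_of_recedingAxis_zoom` (KNSS Lemma 6.1 rate-free + sliding lemma +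
2½-D Liouville, all kernel) the extracted inner object is CONSTANT IN SPACE — type (I-4)(α) — with no conjecture:

* `zoom_hsym_of_meridional` — the receding-axis symmetry of the zoom slices;
* `innerLimit_const_caseB_standing` — **Case B ⇒ constant inner object, from the standing hypotheses.**

**Nothing here asserts that `u` is unbounded or that Case B occurs.** «violates: n/a — dictionary»; bears_on LADDER-NS N5/Z1 →
N1 linear core / N0⁻ ((I-2)/(I-3)/(C6)). Author: ns-blowup-profile-eng-1 g7, 2026-08-27.
-/

open Real Filter Topology Set MeasureTheory Function
open scoped ENNReal
open Literature.Analysis.FluidPDE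

namespace Summit.NavierStokesRegularity.OSWSelfSimilar
namespace TypeIIModulationDictionary

section CaseBStanding

variable {T : ℝ} {u : ℝ → EuclideanSpace ℝ (Fin 3) → EuclideanSpace ℝ (Fin 3)}
  {p : ℝ → EuclideanSpace ℝ (Fin 3) → ℝ}

/-- **The zoom about meridional centres is axisymmetric about receding axes**: if every slice `u t` is axisymmetric and
`xₖ = rₖ e₀ + zₖ e₂`, then for every `s` the zoom slice `(λₖ • stPull λₖ² λₖ tₖ xₖ u) s = y ↦ λₖ u(tₖ + λₖ² s, xₖ + λₖ y)`
satisfies `V(c + R_θ(y − c)) = R_θ V(y)` with `c = −(rₖ/λₖ) e₀` (part XV `zoom_rot_about`). [new here — dictionary] -/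
theorem zoom_hsym_of_meridional (haxi : ∀ t, IsAxisymmetric (u t)) {tn lamn rn zn : ℕ → ℝ}
    (hlam : ∀ k, 0 < lamn k) (k : ℕ) (s θ : ℝ) (y : EuclideanSpace ℝ (Fin 3)) :
    (lamn k • stPull (lamn k ^ 2) (lamn k) (tn k)
        (EuclideanSpace.single 0 (rn k) + EuclideanSpace.single 2 (zn k)) u) s
      (EuclideanSpace.single 0 (-(rn k / lamn k)) +
        rotZ θ (y - EuclideanSpace.single 0 (-(rn k / lamn k)))) =
    rotZ θ ((lamn k • stPull (lamn k ^ 2) (lamn k) (tn k)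
        (EuclideanSpace.single 0 (rn k) + EuclideanSpace.single 2 (zn k)) u) s y) := by
  simp only [Pi.smul_apply, stPull_apply]
  exact zoom_rot_about (haxi _) (hlam k).ne' θ y

/-- **TEMPLATE (I-3), CASE B FROM THE STANDING HYPOTHESES ⇒ CONSTANT INNER OBJECT (no conjecture).** Let `u` be a
classical solution (`ν = 1`, unforced) on `[0, T⋆) × ℝ³` with axisymmetric slices, bounded with bounded energy on every
closed sub-slab; let `tₖ ∈ [t₁, T⋆)` (`t₁ > 0`), `λₖ > 0`, `λₖ → 0`, meridional centres `xₖ = rₖ e₀ + zₖ e₂` with the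
gauge N-a normalisation `λₖ‖u(t, x)‖ ≤ 1` on `[0, tₖ]` and `λₖ‖u(tₖ, xₖ)‖ → 1`, and suppose CASE B: `rₖ/λₖ → ∞`. Then a
subsequence of the zoom converges slice-wise locally uniformly to a KNSS blow-up limit `W` which is CONSTANT IN SPACE on
every slice (`W(s, y) = W(s, 0)`; type (I-4)(α)). Parts XV + XIX + XX + the tree's KNSS Lemma 6.1 (rate-free), sliding
lemma and 2½-D Liouville theorem. [new here — dictionary] -/
theorem innerLimit_const_caseB_standing (hu : IsClassicalNSSolutionOn (Ico 0 T) 1 0 u p)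
    (haxi : ∀ t, IsAxisymmetric (u t))
    (hE : ∀ S < T, ∃ C : ℝ≥0∞, C < ⊤ ∧ ∀ t ∈ Icc 0 S, ∫⁻ x, ‖u t x‖ₑ ^ 2 ≤ C)
    (hbdd : ∀ S < T, ∃ N : ℝ, 0 < N ∧ ∀ t ∈ Icc 0 S, ∀ x, ‖u t x‖ ≤ N)
    {tn lamn rn zn : ℕ → ℝ} {t₁ : ℝ} (ht₁ : 0 < t₁) (htn : ∀ k, t₁ ≤ tn k ∧ tn k < T)
    (hlam : ∀ k, 0 < lamn k) (hlam0 : Tendsto lamn atTop (𝓝 0))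
    (hgauge : ∀ k, ∀ t ∈ Icc 0 (tn k), ∀ x, lamn k * ‖u t x‖ ≤ 1)
    (hnear : Tendsto (fun k => lamn k *
      ‖u (tn k) (EuclideanSpace.single 0 (rn k) + EuclideanSpace.single 2 (zn k))‖) atTop (𝓝 1))
    (hcaseB : Tendsto (fun k => rn k / lamn k) atTop atTop) :
    ∃ (φ : ℕ → ℕ) (W : ℝ → EuclideanSpace ℝ (Fin 3) → EuclideanSpace ℝ (Fin 3)), StrictMono φ ∧
      IsKNSSBlowupLimit W ∧
      (∀ s < 0, TendstoLocallyUniformly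
        (fun k => (lamn (φ k) • stPull (lamn (φ k) ^ 2) (lamn (φ k)) (tn (φ k))
          (EuclideanSpace.single 0 (rn (φ k)) + EuclideanSpace.single 2 (zn (φ k))) u) s) (W s) atTop) ∧
      ∀ s < 0, ∀ y : EuclideanSpace ℝ (Fin 3), W s y = W s 0 := by
  -- the windows and the Oseen-mild zoom (part XX)
  set xn : ℕ → EuclideanSpace ℝ (Fin 3) := fun k => EuclideanSpace.single 0 (rn k) + EuclideanSpace.single 2 (zn k)
    with hxn
  set A : ℕ → ℝ := fun k => -tn k / lamn k ^ 2 with hA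
  set B : ℕ → ℝ := fun k => (T - tn k) / lamn k ^ 2 with hB
  have hBpos : ∀ k, 0 < B k := fun k => div_pos (sub_pos.2 (htn k).2) (pow_pos (hlam k) 2)
  have hAlim : Tendsto A atTop atBot := by
    have hl2 : Tendsto (fun k => lamn k ^ 2) atTop (𝓝[>] 0) := by
      refine tendsto_nhdsWithin_iff.2 ⟨by simpa using hlam0.pow 2, Eventually.of_forall fun k => ?_⟩
      exact pow_pos (hlam k) 2
    have hinv : Tendsto (fun k => (lamn k ^ 2)⁻¹) atTop atTop := tendsto_inv_nhdsGT_zero.comp hl2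
    have hmaj : Tendsto (fun k => -t₁ * (lamn k ^ 2)⁻¹) atTop atBot :=
      hinv.const_mul_atTop_of_neg (by linarith)
    refine tendsto_atBot_mono (fun k => ?_) hmaj
    have hl2k : 0 < lamn k ^ 2 := pow_pos (hlam k) 2
    show -tn k / lamn k ^ 2 ≤ -t₁ * (lamn k ^ 2)⁻¹
    rw [div_eq_mul_inv]
    exact mul_le_mul_of_nonneg_right (by linarith [(htn k).1]) (inv_nonneg.2 hl2k.le)
  have hbd1 : ∀ k, ∀ τ ∈ Ioc (A k) 0, ∀ x,
      ‖(lamn k • stPull (lamn k ^ 2) (lamn k) (tn k) (xn k) u) τ x‖ ≤ 1 := by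
    intro k τ hτ x
    have hl2k : 0 < lamn k ^ 2 := pow_pos (hlam k) 2
    have h1 : 0 ≤ tn k + lamn k ^ 2 * τ := by
      have : -tn k / lamn k ^ 2 < τ := hτ.1
      rw [div_lt_iff₀ hl2k] at this; linarith
    have h2 : tn k + lamn k ^ 2 * τ ≤ tn k := by nlinarith [hτ.2]
    have h := hgauge k (tn k + lamn k ^ 2 * τ) ⟨h1, h2⟩ (xn k + lamn k • x)
    simpa [stPull_apply, norm_smul, abs_of_pos (hlam k)] using h
  have hvert : Tendsto (fun k => ‖(lamn k • stPull (lamn k ^ 2) (lamn k) (tn k) (xn k) u) 0 0‖) atTop (𝓝 1) := by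
    refine hnear.congr fun k => ?_
    simp [hxn, stPull_apply, norm_smul, abs_of_pos (hlam k)]
  exact innerLimit_const_of_recedingAxis_zoom (A := A) (B := B)
    (w := fun k => lamn k • stPull (lamn k ^ 2) (lamn k) (tn k) (xn k) u)
    (q := fun k => lamn k ^ 2 • stPull (lamn k ^ 2) (lamn k) (tn k) (xn k) p) hAlim hBpos
    (fun k => zoom_isClassical hu (hlam k) (tn k) (xn k))
    (fun k s t hs hst ht x => zoom_oseenMild hu hE hbdd (hlam k) (tn k) (xn k) hs hst ht x)
    hbd1 hvert hcaseB (fun k s _ θ y => zoom_hsym_of_meridional haxi hlam k s θ y)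

end CaseBStanding

end TypeIIModulationDictionary
end Summit.NavierStokesRegularity.OSWSelfSimilar
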